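import Literature.MathematicalPhysics.QuantumFieldTheory.Balaban1983to89.B1Sect3Statements

/-!
# `Balaban1983to89.B1Step363Proof` — T. Bałaban, *(Higgs)₂,₃ quantum fields in a finite volume. I. A lower bound*,
Commun. Math. Phys. **85** (1982) 603–626 [Balaban1982Higgs1]: the closing step of the inductive proof of the
perturbative formula, **(3.63) + (3.65) ⇒ (3.36) at k+1** (p. 624), i.e. the deferred implication
`B1Sect3Statements.Step363 ⇐ B1Sect3Statements.Eq365`, PROVED — unconditionally (no differentiability hypothesis is
needed: a constant added to the generating function drops out of every mixed Taylor coefficient of positive order and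
contributes itself at order `(0, 0)`); theorems only

statement-level skeleton of published theorems with citation tags; proofs where landed; nothing here is a claim about the Yang–Mills mass gap

PDF held: `paper:balaban1982-cmp85-higgs23-i` (journal page = PDF page + 602); (3.36) p. 618 and (3.62)–(3.65) p. 624 READ AS
IMAGES on the x2 renders `run/shared/lean/pub/pub-balaban/b2b-balaban-ref1/pages/1982-cmp85-higgs23-I/…-p016-x2.png`,
`…-p022-x2.png`.

CITATION HEADER (lean-in-tree rule).  WHAT IS REPRODUCED — SKELETON rows **B1.Eq3.62–3.63** and **B1.Eq3.65** (reader r12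
`lit-balaban-r12/ROWS-B1-part2.md`: decls `B1Sect3Statements.pertSum362`, `Eq336`, `Step363`, `Eq365`, «typed p239973 ·
shapes»; `Step363`'s docstring: *"proof deferred to the differentiability bookkeeping"*).  Verbatim, p. 624 [PDF 22]:
*"Hence we have S^{(k+1),L^{k+1}ε}(B, ψ) = Σ_{0≤α+β≤n̄} (1/(α!β!)) e^αλ^β (∂^{α+β}/∂e′^α∂λ′^β E′(e′, λ′, B, ψ))|_{e′=λ′=0}, (3.63)
where E′ is an expression given by the formula (3.61) only instead of the Taylor expansion of the function E_k in the
exponent we have the function E_k(e′, λ′, eB^{(k+1)ε} + e′A′^{(k)ε}, φ) itself. … Taking into account the law of composition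
of the renormalization transformations (2.14) and the convention (3.34) we obtain the following equality
E′(e′, λ′, B, ψ) = ½⟨B, Δ^{(k+1),L^{k+1}ε}B⟩ + E_{k+1}(e′, λ′, eB^{(k+1)ε}, ψ). (3.65)  If we substitute in the formula (3.63)
the above expression for E′ and if we change B, ψ into A, φ, then we get precisely the formula (3.35)* [sic: (3.36), r12
transcript note T5] *for S^{(k+1),L^{k+1}ε}. Thus we have finished the inductive proof of the formula (3.63) for the k^{th}
action."*; p. 618 [PDF 16]: *"The action S^{(k),L^kε} can be written in the form S^{(k),L^kε}(A, φ) = ½⟨A, Δ^{(k),L^kε}A⟩ +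
Σ_{0≤α+β≤n̄} (1/(α!β!)) e^αλ^β (∂^{α+β}/∂e′^α∂λ′^β E_k(e′, λ′, eA^{(k),ε}, φ))|_{e′=λ′=0}. (3.36)"*.

THE TYPING OF RECORD (r12, `B1Sect3Statements`, not restated): `pertSum362 E e lam nbar` = the truncated double Taylor sum
`Σ_{0≤α+β≤n̄} (1/(α!β!)) e^αλ^β ∂^α_{e′}∂^β_{λ′}E(e′,λ′)|₀` of a generating function `E : ℝ → ℝ → ℝ` (fields fixed), the mixed
partial as the iterated one-variable derivatives `iteratedDeriv α (fun e′ ↦ iteratedDeriv β (fun l′ ↦ E e′ l′) 0) 0`;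
`Eq336 S quadA E e lam nbar : S = ½quadA + pertSum362 E e lam nbar`; `Eq365 E′ Enext quadB : ∀ e′ l′, E′ e′ l′ = ½quadB +
Enext e′ l′`; `Step363 E′ Enext quadB e lam nbar : pertSum362 E′ e lam nbar = ½quadB + pertSum362 Enext e lam nbar`.

WHAT THIS FILE PROVES (theorems only — no `def`, no new `Prop` fact; 0 `sorry`; standard axioms):
* `iteratedDeriv₂_const_add` — the mixed Taylor coefficient of `(e′, λ′) ↦ c + E(e′, λ′)` at `0` equals that of `E` plus
  `c` exactly at order `(0, 0)` — for EVERY function `E` (Mathlib `iteratedDeriv_const_add` is hypothesis-free: a constant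
  shift preserves (non-)differentiability);
* `pertSum362_const_add` — hence `pertSum362 (c + E) = c + pertSum362 E` (only the `(α, β) = (0, 0)` term, weight
  `1/(0!0!)·e⁰λ⁰ = 1`, sees the constant);
* **`step363_of_eq365`** — `Eq365 E′ Enext quadB → Step363 E′ Enext quadB e lam nbar` for all `e, λ, n̄`: the substitution
  of (3.65) into (3.63);
* **`eq336_succ`** — the sentence: (3.63) for `S^{(k+1)}` and (3.65) give (3.36) at `k + 1`,
  `Eq336 S quadB E_{k+1} e lam nbar`; `step363_iff` — conversely (3.36) at `k+1` and (3.65) give back (3.63).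
HONEST SCOPE.  This is the algebra of the printed substitution only; the objects `E′`, `E_{k+1}` (the integrals (3.61)/(3.64),
rows B1.Eq3.60b–3.61/B1.Eq3.64, absent) and the identity (3.65) itself (an instance of the composition law (2.14),
`B1RTSemigroup.display214`, with the convention (3.34)) are arguments/hypotheses, as in the typing of record.
Unit `lit-balaban-p14` gen 3 (Phase-2 proof seat p14, literature-prover-lit-balaban-p14-g3-0), HOME
`run/shared/lean/pub/lit-balaban/` (seat log `lit-balaban-p14/STATUS.md`).
-/

namespace Literature.MathematicalPhysics.QuantumFieldTheory.Balaban1983to89.B1Step363Proof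

open Literature.MathematicalPhysics.QuantumFieldTheory.Balaban1983to89
open B1Sect3Statements

/-! ## §1 A constant shift of the generating function moves only the order-(0,0) Taylor coefficient -/

/-- One variable: the `β`-th derivative at `0` of `l′ ↦ c + f l′` is that of `f`, plus `c` iff `β = 0` — for every `f`
(`iteratedDeriv_const_add` needs no differentiability). [cite: Balaban1982Higgs1, (3.63)–(3.65) p.624] -/
theorem iteratedDeriv_const_add_ite (β : ℕ) (c : ℝ) (f : ℝ → ℝ) :
    iteratedDeriv β (fun l' => c + f l') 0 = (if β = 0 then c else 0) + iteratedDeriv β f 0 := by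
  rcases Nat.eq_zero_or_pos β with rfl | hβ
  · simp
  · rw [iteratedDeriv_const_add hβ, if_neg hβ.ne', zero_add]

/-- Two variables: the mixed Taylor coefficient `∂^α_{e′}∂^β_{λ′}(c + E)(0,0)` (iterated one-variable derivatives, as in
`pertSum362`) equals that of `E`, plus `c` iff `(α, β) = (0, 0)` — for every `E : ℝ → ℝ → ℝ`.
[cite: Balaban1982Higgs1, (3.63)–(3.65) p.624] -/
theorem iteratedDeriv₂_const_add (α β : ℕ) (c : ℝ) (E : ℝ → ℝ → ℝ) :
    iteratedDeriv α (fun e' => iteratedDeriv β (fun l' => c + E e' l') 0) 0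
      = (if α = 0 ∧ β = 0 then c else 0) + iteratedDeriv α (fun e' => iteratedDeriv β (fun l' => E e' l') 0) 0 := by
  simp_rw [iteratedDeriv_const_add_ite β c]
  rcases Nat.eq_zero_or_pos α with rfl | hα
  · simp
  · rw [iteratedDeriv_const_add hα, if_neg (fun h => hα.ne' h.1), zero_add]

/-- The truncated double Taylor sum (3.62) of a constant-shifted generating function: `pertSum362 (c + E) = c +
pertSum362 E` — only the term `(α, β) = (0, 0)` (weight `1/(0!0!)·e⁰λ⁰ = 1`, always inside `0 ≤ α + β ≤ n̄`) sees `c`.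
[cite: Balaban1982Higgs1, (3.63)–(3.65) p.624] -/
theorem pertSum362_const_add (c : ℝ) (E : ℝ → ℝ → ℝ) (e lam : ℝ) (nbar : ℕ) :
    pertSum362 (fun e' l' => c + E e' l') e lam nbar = c + pertSum362 E e lam nbar := by
  unfold pertSum362
  simp_rw [iteratedDeriv₂_const_add, mul_add, Finset.sum_add_distrib]
  congr 1
  rw [Finset.sum_eq_single (0, 0)]
  · simp
  · intro ab _ hne
    have h : ¬ (ab.1 = 0 ∧ ab.2 = 0) := fun h => hne (Prod.ext h.1 h.2)
    rw [if_neg h, mul_zero]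
  · intro h0
    exact absurd (by simp) h0

/-! ## §2 (3.63) + (3.65) ⇒ (3.36) at k + 1 -/

/-- **`Step363 ⇐ Eq365` — (3.65) substituted into (3.63), p. 624**: if `E′(e′, λ′, B, ψ) = ½⟨B, Δ^{(k+1),L^{k+1}ε}B⟩ +
E_{k+1}(e′, λ′, eB^{(k+1)ε}, ψ)` for all `e′, λ′` (`Eq365`), then the perturbative sums (3.62)/(3.63) of `E′` and of
`E_{k+1}` differ exactly by the quadratic term: `pertSum362 E′ e λ n̄ = ½⟨B, ΔB⟩ + pertSum362 E_{k+1} e λ n̄` (`Step363`) —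
for all couplings `e, λ` and every order `n̄`, with no regularity assumption on the generating functions.
[cite: Balaban1982Higgs1, (3.63)–(3.65) p.624] -/
theorem step363_of_eq365 {E' Enext : ℝ → ℝ → ℝ} {quadB : ℝ} (h : Eq365 E' Enext quadB) (e lam : ℝ) (nbar : ℕ) :
    Step363 E' Enext quadB e lam nbar := by
  have hE : E' = fun e' l' => 1 / 2 * quadB + Enext e' l' := funext fun e' => funext fun l' => h e' l'
  unfold Step363
  rw [hE, pertSum362_const_add]

/-- **The sentence p. 624** — *"If we substitute in the formula (3.63) the above expression for E′ … then we get precisely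
the formula (3.36) for S^{(k+1),L^{k+1}ε}. Thus we have finished the inductive proof"*: (3.63) `S^{(k+1)} = pertSum362 E′`
and (3.65) give (3.36) at level `k + 1`, `S^{(k+1)} = ½⟨B, Δ^{(k+1),L^{k+1}ε}B⟩ + Σ (1/(α!β!)) e^αλ^β ∂E_{k+1}|₀`
(`B1Sect3Statements.Eq336` with the level-(k+1) data). [cite: Balaban1982Higgs1, (3.63)–(3.65) p.624; (3.36) p.618] -/
theorem eq336_succ {S : ℝ} {E' Enext : ℝ → ℝ → ℝ} {quadB e lam : ℝ} {nbar : ℕ}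
    (h363 : S = pertSum362 E' e lam nbar) (h365 : Eq365 E' Enext quadB) : Eq336 S quadB Enext e lam nbar := by
  unfold Eq336
  rw [h363]
  exact step363_of_eq365 h365 e lam nbar

/-- Conversely, under (3.65) the level-(k+1) form (3.36) gives back (3.63): the two displays are the same statement once
(3.65) holds. [cite: Balaban1982Higgs1, (3.63)–(3.65) p.624] -/
theorem step363_iff {S : ℝ} {E' Enext : ℝ → ℝ → ℝ} {quadB e lam : ℝ} {nbar : ℕ} (h365 : Eq365 E' Enext quadB) :
    S = pertSum362 E' e lam nbar ↔ Eq336 S quadB Enext e lam nbar := by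
  unfold Eq336
  rw [show pertSum362 E' e lam nbar = 1 / 2 * quadB + pertSum362 Enext e lam nbar from
    step363_of_eq365 h365 e lam nbar]

/-- Order zero sanity check of the typing of record: at `n̄ = 0` the perturbative sum (3.62) is the value of the generating
function at zero couplings, `pertSum362 E e λ 0 = E(0, 0)`. [cite: Balaban1982Higgs1, (3.62) p.624] -/
theorem pertSum362_zero (E : ℝ → ℝ → ℝ) (e lam : ℝ) : pertSum362 E e lam 0 = E 0 0 := by
  unfold pertSum362
  rw [show (Finset.range (0 + 1) ×ˢ Finset.range (0 + 1)).filter (fun ab : ℕ × ℕ => ab.1 + ab.2 ≤ 0) = {(0, 0)} by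
    decide]
  simp

end Literature.MathematicalPhysics.QuantumFieldTheory.Balaban1983to89.B1Step363Proof
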